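import Summits.RiemannHypothesis.RiemannHypothesis.Theorems.PfPersistenceGalerkinFormDomain
import Summits.RiemannHypothesis.RiemannHypothesis.Theorems.PfPersistenceCollarBound
import Literature.NumberTheory.LFunctions.WeilExplicitProofs
import HarnessLib

/-!
# PF persistence — GAL-0 piece (ii), STEP 3a: the Mellin transform of the autocorrelation of a
# NON-SMOOTH window profile on the critical line (pub-rhpf barrier-prover g2)

HONEST FRAMING: long-odds mechanism search; no RH claims.  Companion of
`Theorems/PfPersistenceGalerkinFormDomain.lean` (GAL-0 typed: `GalerkinRayleighRitz` ⇐
`GalerkinMatrixIdentity` ∧ `CutoffProfileFormDensity`) and of the proof plan for piece (ii)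
(`HOME/pub-rhpf-barrier-prover/PROOF-PLAN.md`, 2026-08-19T12:3xZ).

The cut-off Galerkin profile `G = cutoffProfile win v = 1_{[-a,a]} · θ_v` is bounded, even,
compactly supported and INTEGRABLE, but it is NOT continuous (it jumps at `±a`), so the tree's
transform lemmas `weilMellin_weilConv_holds` (continuous factors) and
`weilMellin_weilQuadratic_of_re_eq` (smooth tests) do not apply to it.  This file removes the
continuity hypothesis: the transform of a convolution is the product of the transforms as soon
as the two exponentially weighted factors are integrable (same Fubini proof), hence ON THE
CRITICAL LINE the transform of the autocorrelation `G ⋆ G̃` of ANY integrable `G` is the squared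
modulus `|Ĝ(½ + it)|²` — in particular it is real and non-negative.  This is the input both
to piece (i) (cand-3: evaluating `Re Q(cutoffProfile)` through the explicit formula, whose
archimedean side is `(1/2π) ∫ |Ĝ(½+it)|² Re ψ(¼ + it/2) dt - A(0) log π`) and to piece (ii) /
barrier-typer's (ii′) (the dominated-convergence majorant is built on `|Ĝ(½+it)|²`).

PROVED here (RH-free, no data, no named facts beyond the tree's discharged transform API):
* `weilMellin_weilConv_of_integrable` — `(g ⋆ h)^(s) = ĝ(s) ĥ(s)` under integrability of
  `g e^{(s-½)·}` and `h e^{(s-½)·}` only;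
* `integrable_mul_cexp_half`, `integrable_weilReflect` — on `Re s = ½` the weight is unimodular;
* `weilMellin_autocorr_half` — `(G ⋆ G̃)^(½+it) = |Ĝ(½+it)|²` for every integrable `G`;
  `weilMellin_autocorr_half_re_nonneg`, `weilMellin_autocorr_half_im`;
* `cutoffProfile_neg`, `integrable_cutoffProfile`, `cutoffProfile_eq_zero_of_lt`,
  `weilMellin_cutoffProfile_autocorr_half` — the instance for the cut-off Galerkin profile.
-/

set_option linter.dupNamespace false

noncomputable section

open Complex Filter Set MeasureTheory Matrix
open scoped Real Topology Convolution ComplexConjugate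

namespace Summit.RiemannHypothesis.RiemannHypothesis.Theorems.PfPersistence

open Literature.NumberTheory.LFunctions

/-! ## §1 Transform of a convolution without continuity -/

/-- `(g ⋆ h)^(s) = ĝ(s) · ĥ(s)` whenever `u ↦ g(u) e^{(s-½)u}` and `u ↦ h(u) e^{(s-½)u}` are
integrable (Fubini, `MeasureTheory.integral_convolution`; the tree's `weilMellin_weilConv_holds`
is the continuous compactly supported case). [folklore] -/
theorem weilMellin_weilConv_of_integrable {g h : ℝ → ℂ} (s : ℂ)
    (hG : Integrable fun u : ℝ ↦ g u * cexp ((s - 1 / 2) * u))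
    (hH : Integrable fun u : ℝ ↦ h u * cexp ((s - 1 / 2) * u)) :
    weilMellin (weilConv g h) s = weilMellin g s * weilMellin h s := by
  set c : ℂ := s - 1 / 2 with hc
  set G : ℝ → ℂ := fun u ↦ g u * cexp (c * u) with hGdef
  set H : ℝ → ℂ := fun u ↦ h u * cexp (c * u) with hHdef
  have key : ∀ t : ℝ, weilConv g h t * cexp (c * t) = (G ⋆[ContinuousLinearMap.mul ℂ ℂ] H) t := by
    intro t
    rw [weilConv_apply, convolution_def, ← integral_mul_const]
    congr 1 with u
    simp only [hGdef, hHdef, ContinuousLinearMap.mul_apply']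
    have he : cexp (c * t) = cexp (c * u) * cexp (c * ((t - u : ℝ) : ℂ)) := by
      rw [← Complex.exp_add]
      push_cast
      ring_nf
    rw [he]
    ring
  have hL : weilMellin (weilConv g h) s = ∫ t : ℝ, (G ⋆[ContinuousLinearMap.mul ℂ ℂ] H) t := by
    unfold weilMellin
    exact integral_congr_ae (Eventually.of_forall fun t ↦ key t)
  rw [hL, integral_convolution (ContinuousLinearMap.mul ℂ ℂ) hG hH, ContinuousLinearMap.mul_apply']
  rfl

/-- On the critical line the Mellin weight is unimodular: `‖e^{((½+it)-½)u}‖ = 1`. [folklore] -/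
theorem norm_cexp_half_weight (t u : ℝ) : ‖cexp ((1 / 2 + t * I - 1 / 2) * u)‖ = 1 := by
  rw [show (1 / 2 + (t : ℂ) * I - 1 / 2) * (u : ℂ) = ((t * u : ℝ) : ℂ) * I by push_cast; ring]
  exact Complex.norm_exp_ofReal_mul_I _

/-- An integrable function stays integrable against the critical-line weight. [folklore] -/
theorem integrable_mul_cexp_half {G : ℝ → ℂ} (hG : Integrable G) (t : ℝ) :
    Integrable fun u : ℝ ↦ G u * cexp ((1 / 2 + t * I - 1 / 2) * u) := by
  exact (hG.bdd_mul (c := 1) (by fun_prop)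
    (Eventually.of_forall fun u ↦ (norm_cexp_half_weight t u).le)).congr
    (Eventually.of_forall fun u ↦ mul_comm _ _)

/-- The reflection `G̃(u) = conj G(-u)` of an integrable function is integrable. [folklore] -/
theorem integrable_weilReflect {G : ℝ → ℂ} (hG : Integrable G) : Integrable (weilReflect G) := by
  unfold weilReflect
  have h1 : Integrable (fun u : ℝ ↦ G (-u)) := hG.comp_neg
  exact (Complex.conjLIE.toContinuousLinearMap.integrable_comp h1 :)

/-! ## §2 The autocorrelation on the critical line is a squared modulus -/

/-- **`(G ⋆ G̃)^(½ + it) = |Ĝ(½ + it)|²` for every integrable `G`** (Bombieri 2000 §3 (3.2) for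
smooth tests; here without smoothness or continuity). [folklore] -/
theorem weilMellin_autocorr_half {G : ℝ → ℂ} (hG : Integrable G) (t : ℝ) :
    weilMellin (weilConv G (weilReflect G)) (1 / 2 + t * I) =
      (Complex.normSq (weilMellin G (1 / 2 + t * I)) : ℂ) := by
  rw [weilMellin_weilConv_of_integrable _ (integrable_mul_cexp_half hG t)
    (integrable_mul_cexp_half (integrable_weilReflect hG) t), weilMellin_weilReflect_holds]
  have h1 : 1 - conj (1 / 2 + (t : ℂ) * I) = 1 / 2 + t * I := by
    apply Complex.ext
    · simp; norm_num
    · simp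
  rw [h1, Complex.mul_conj]

/-- Its real part is non-negative. [folklore] -/
theorem weilMellin_autocorr_half_re_nonneg {G : ℝ → ℂ} (hG : Integrable G) (t : ℝ) :
    0 ≤ (weilMellin (weilConv G (weilReflect G)) (1 / 2 + t * I)).re := by
  rw [weilMellin_autocorr_half hG t, Complex.ofReal_re]
  exact Complex.normSq_nonneg _

/-- Its imaginary part vanishes. [folklore] -/
theorem weilMellin_autocorr_half_im {G : ℝ → ℂ} (hG : Integrable G) (t : ℝ) :
    (weilMellin (weilConv G (weilReflect G)) (1 / 2 + t * I)).im = 0 := by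
  rw [weilMellin_autocorr_half hG t, Complex.ofReal_im]

/-- Its norm is the squared norm of `Ĝ`. [folklore] -/
theorem norm_weilMellin_autocorr_half {G : ℝ → ℂ} (hG : Integrable G) (t : ℝ) :
    ‖weilMellin (weilConv G (weilReflect G)) (1 / 2 + t * I)‖ =
      ‖weilMellin G (1 / 2 + t * I)‖ ^ 2 := by
  rw [weilMellin_autocorr_half hG t, Complex.norm_of_nonneg (Complex.normSq_nonneg _),
    Complex.normSq_eq_norm_sq]

/-! ## §3 The cut-off Galerkin profile -/

/-- The cut-off profile is EVEN. [folklore] -/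
theorem cutoffProfile_neg (win : Window) (v : Fin (win.N + 1) → ℝ) (t : ℝ) :
    cutoffProfile win v (-t) = cutoffProfile win v t := by
  simp only [cutoffProfile]
  congr 1
  by_cases ht : t ∈ Icc (-win.a) win.a
  · have hnt : -t ∈ Icc (-win.a) win.a := ⟨by linarith [ht.2], by linarith [ht.1]⟩
    rw [indicator_of_mem ht, indicator_of_mem hnt, CollarBound.profile_neg_arg]
  · have hnt : -t ∉ Icc (-win.a) win.a := fun h ↦ ht ⟨by linarith [h.2], by linarith [h.1]⟩
    rw [indicator_of_notMem ht, indicator_of_notMem hnt]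

/-- The cut-off profile vanishes outside `[-a, a]`. [folklore] -/
theorem cutoffProfile_eq_zero_of_lt (win : Window) (v : Fin (win.N + 1) → ℝ) {t : ℝ}
    (ht : win.a < |t|) : cutoffProfile win v t = 0 := by
  have hnt : t ∉ Icc (-win.a) win.a := by
    intro h
    have := abs_le.2 ⟨h.1, h.2⟩
    linarith
  simp [cutoffProfile, indicator_of_notMem hnt]

/-- The cut-off profile is integrable (a continuous function cut off to a compact interval). [folklore] -/
theorem integrable_cutoffProfile (win : Window) (v : Fin (win.N + 1) → ℝ) :
    Integrable (cutoffProfile win v) := by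
  have hI : IntegrableOn (profile (2 * win.a) v) (Icc (-win.a) win.a) :=
    (CentralMassFloor.continuous_profile (2 * win.a) v).continuousOn.integrableOn_Icc
  have hR : Integrable (fun t ↦ (Icc (-win.a) win.a).indicator (profile (2 * win.a) v) t) :=
    (integrable_indicator_iff measurableSet_Icc).2 hI
  exact hR.ofReal

/-- The cut-off profile is bounded by the sup of `|θ_v|` on the window. [folklore] -/
theorem exists_norm_cutoffProfile_le (win : Window) (v : Fin (win.N + 1) → ℝ) :
    ∃ C : ℝ, 0 ≤ C ∧ ∀ t, ‖cutoffProfile win v t‖ ≤ C := by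
  obtain ⟨C, hC⟩ := (isCompact_Icc (a := -win.a) (b := win.a)).exists_bound_of_continuousOn
    (CentralMassFloor.continuous_profile (2 * win.a) v).continuousOn
  refine ⟨max C 0, le_max_right _ _, fun t ↦ ?_⟩
  by_cases ht : t ∈ Icc (-win.a) win.a
  · simp only [cutoffProfile, indicator_of_mem ht, Complex.norm_real]
    exact (hC t ht).trans (le_max_left _ _)
  · simp [cutoffProfile, indicator_of_notMem ht]

/-- **STEP 3a for the cut-off Galerkin profile**: on the critical line the transform of its
autocorrelation is `|Ĝ(½+it)|² ≥ 0`. [folklore] -/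
theorem weilMellin_cutoffProfile_autocorr_half (win : Window) (v : Fin (win.N + 1) → ℝ) (t : ℝ) :
    weilMellin (weilConv (cutoffProfile win v) (weilReflect (cutoffProfile win v))) (1 / 2 + t * I) =
      (Complex.normSq (weilMellin (cutoffProfile win v) (1 / 2 + t * I)) : ℂ) :=
  weilMellin_autocorr_half (integrable_cutoffProfile win v) t

end Summit.RiemannHypothesis.RiemannHypothesis.Theorems.PfPersistence
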